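import Summits.QuantumFields.BalabanUV.T4Continuum.Support.NE7SliceStepOneStep
import Summits.QuantumFields.BalabanUV.T4Continuum.Support.PeriodicChoice
import HarnessLib

/-!
# NE7SliceIterationState — THE STATE OF THE (S1) ITERATION AS FUNCTIONS OF THE GAUGE (memo ROAD-G100 §2.1 ∕ §2.7 item F4, first file): `X(u) = log(W⁻¹U′^{u})`, the corner logs `h(u)`,
# the coarse datum `φ(u) = dirIter X(u) − gaugeDir_V h(u)`, the normal∕tangent parts `N(u) = rightInvW φ(u)`, `T(u) = X(u) − N(u)`, a CHOSEN normalised slice split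
# `T(u) = Ỹ(u) + gaugeDir W ζ(u)`, the frame mismatch `m(u)`, the DEFECT `Df(u) = δ(u) + m(u)∕M`, the step `u ↦ e^{−ζ(u)}·u` and the size pair `(s(u), η_h(u))` — the objects the Cauchy engine
# `NE7DefectIterationCauchy.exists_orbit_limit` iterates

Cell `pub-balaban`, rung (B)+1 sub-cell t4, lineage `b2b-balaban-t4-ne7-p1`, generation 101 (CRUX PROVER NE7 #1 = OWNER of BINDER row NE7).  Memo `t4/b2b-balaban-t4-ne7-p1-g101/ROAD-G101.md` §7
(F4 design).  The one-step theorem `NE7SliceStepOneStep.one_step_split_sized`, the identities `NE7SliceStepIdentities` and the uniqueness `NE7SliceSplitUnique` speak of ONE step with all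
objects displayed; the engine needs them as FUNCTIONS of the state `u` (a unitary periodic site gauge).  THIS FILE only DEFINES those functions and proves their elementary access lemmas:
sups over a period box (`siteSup`, `bondSup`: attained for periodic data, so `f y ≤ siteSup P f` and `siteSup P f ≤ c` from a pointwise bound), and the state maps — the normal part through
`rightInvW` behind a `dite` on the skewness of `φ(u)` (true on the working region), the split through `Classical.choose` behind a `dite` on its existence (true on the working region by
`NE7SliceGaugeFunctionSized.exists_fullGauge_split_sized`; its `gaugeDir W ζ(u)` and `Ỹ(u)` are canonical by `NE7SliceSplitUnique.slice_split_unique`).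
WHAT ([folklore]; 12 def, 0 sorry).
§1 `siteSup`, `le_siteSup`, `siteSup_le`, `siteSup_nonneg`; `bondSup`, `le_bondSup`, `bondSup_le`, `bondSup_nonneg`.
§2 `repLog` (`X(u)`), `cornerLog` (`h(u)`), `coarseDatum` (`φ(u)`), `normalPart` (`N(u)`), `normalPart_eq`, `tangentPart` (`T(u)`), `IsNormalisedSplit`, `gaugeFun` (`ζ(u)`), `slicePart` (`Ỹ(u)`),
   `split_spec`, `frameMismatch` (`m(u)`), `sliceDefect` (`Df(u)`), `sliceStep`, `sizePair`.
HONEST FRAMING (page 1): definitions and finite-sup bookkeeping; NO estimate; nothing of Bałaban's asserted; NOT (S1), NOT NE7; spine 0∕9; finite T⁴ rung (B)+1 — NOT infinite volume, NOT mass gap,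
NOT BetaPertH, NOT Clay.  Continuum YM on T⁴ ⇐ BetaPertH ∧ nine spine estimates (0/9 proved); BetaPertH ⇐ (D1) ∧ (D4) ∧ CAP+tail; G-an2-4 gates asym, D1 and NE2/3/4.
-/

set_option autoImplicit false

open scoped BigOperators Matrix.Norms.L2Operator
open Finset

namespace Summit.QuantumFields.BalabanUV.T4Continuum.NE7SliceIterationState

open Literature.MathematicalPhysics.QuantumFieldTheory.Balaban1983to89
open B7Prop1Explicit B7Prop2Explicit MatrixLog
open T4AveragingDeficitWall (IsUnitaryCfg IsSkewDir SmallField)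
open T4AveragingDeficitWallBoundary (periodBox)
open AveragingDeficitMultiLevelPrep (cavgIter LevelSmall tower)
open BlockAveragePushDirGauge (gaugeDir)
open NE3TangentCovariantTower (dirIter framePotW)
open NE3CovariantBlockMean (bmeanIterW)
open NE3QbarIterCovLiftPrep (cruxC)
open NE3SmoothRightInverseW (rightInvW)
open NE7MeanZeroGaugeSliceW (energyBlockLandauW)
open PeriodicChoice (wrap_mem_periodBox apply_wrap_eq)

noncomputable section

variable {d : ℕ} {n : Type*} [Fintype n] [DecidableEq n]

/-! ## §1 Sups over a period box -/

omit [Fintype n] [DecidableEq n] in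
/-- the sup of a real site function over the period box `[0,P)^d` (`0` if the box is empty). [folklore] -/
def siteSup (P : ℕ) (f : Site d → ℝ) : ℝ :=
  if h : (periodBox (d := d) P).Nonempty then (periodBox (d := d) P).sup' h f else 0

omit [Fintype n] [DecidableEq n] in
/-- a `P`-periodic site function is below its box sup everywhere (`P ≥ 1`). [folklore] -/
theorem le_siteSup {P : ℕ} (hP : 1 ≤ P) {f : Site d → ℝ} (hf : ∀ (x : Site d) (κ : Fin d), f (x + (P : ℤ) • e κ) = f x) (y : Site d) :
    f y ≤ siteSup P f := by
  have hne : (periodBox (d := d) P).Nonempty := ⟨_, wrap_mem_periodBox P hP y⟩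
  rw [siteSup, dif_pos hne, ← apply_wrap_eq hf y]
  exact Finset.le_sup' f (wrap_mem_periodBox P hP y)

omit [Fintype n] [DecidableEq n] in
/-- a pointwise bound bounds the box sup (`P ≥ 1`). [folklore] -/
theorem siteSup_le {P : ℕ} (hP : 1 ≤ P) {f : Site d → ℝ} {c : ℝ} (h : ∀ y, f y ≤ c) : siteSup P f ≤ c := by
  have hne : (periodBox (d := d) P).Nonempty := ⟨_, wrap_mem_periodBox P hP 0⟩
  rw [siteSup, dif_pos hne]
  exact Finset.sup'_le hne f fun y _ => h y

omit [Fintype n] [DecidableEq n] in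
/-- the box sup of a nonnegative function is nonnegative. [folklore] -/
theorem siteSup_nonneg {P : ℕ} {f : Site d → ℝ} (h : ∀ y, 0 ≤ f y) : 0 ≤ siteSup P f := by
  unfold siteSup
  split_ifs with hne
  · obtain ⟨y, hy⟩ := hne
    exact (h y).trans (Finset.le_sup' f hy)
  · exact le_rfl

omit [Fintype n] [DecidableEq n] in
/-- the sup of a real bond function over the bonds of the period box (`0` on empty index sets). [folklore] -/
def bondSup (P : ℕ) (F : Site d → Fin d → ℝ) : ℝ :=
  siteSup P fun y => if h : (Finset.univ : Finset (Fin d)).Nonempty then Finset.univ.sup' h (F y) else 0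

omit [Fintype n] [DecidableEq n] in
/-- a `P`-periodic bond function is below its box sup everywhere (`P ≥ 1`). [folklore] -/
theorem le_bondSup {P : ℕ} (hP : 1 ≤ P) {F : Site d → Fin d → ℝ} (hF : ∀ (x : Site d) (κ μ : Fin d), F (x + (P : ℤ) • e κ) μ = F x μ) (y : Site d) (μ : Fin d) :
    F y μ ≤ bondSup P F := by
  have hne : (Finset.univ : Finset (Fin d)).Nonempty := ⟨μ, Finset.mem_univ _⟩
  refine le_trans ?_ (le_siteSup hP (f := fun y => if h : (Finset.univ : Finset (Fin d)).Nonempty then Finset.univ.sup' h (F y) else 0) (fun x κ => ?_) y)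
  · simp only [dif_pos hne]
    exact Finset.le_sup' (F y) (Finset.mem_univ μ)
  · simp only [dif_pos hne]
    exact congrArg _ (funext fun ν => hF x κ ν)

omit [Fintype n] [DecidableEq n] in
/-- a pointwise bound by `c ≥ 0` bounds the bond box sup (`P ≥ 1`). [folklore] -/
theorem bondSup_le {P : ℕ} (hP : 1 ≤ P) {F : Site d → Fin d → ℝ} {c : ℝ} (hc : 0 ≤ c) (h : ∀ y μ, F y μ ≤ c) : bondSup P F ≤ c := by
  refine siteSup_le hP fun y => ?_
  split_ifs with hne
  · exact Finset.sup'_le hne (F y) fun μ _ => h y μ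
  · exact hc

omit [Fintype n] [DecidableEq n] in
/-- the bond box sup of a nonnegative function is nonnegative. [folklore] -/
theorem bondSup_nonneg {P : ℕ} {F : Site d → Fin d → ℝ} (h : ∀ y μ, 0 ≤ F y μ) : 0 ≤ bondSup P F := by
  refine siteSup_nonneg fun y => ?_
  split_ifs with hne
  · obtain ⟨μ, hμ⟩ := hne
    exact (h y μ).trans (Finset.le_sup' (F y) hμ)
  · exact le_rfl

/-! ## §2 The state maps -/

/-- **`X(u)`**: the log of the regauged pair, `X(u)(b) := mlog(W(b)⁻¹·U′^{u}(b))` (so `U′^{u} = W·e^{X(u)}` on the working region, `NE7SliceStepIdentities.step_rep`). [folklore] -/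
def repLog (W U' : Site d → Fin d → (Matrix n n ℂ)ˣ) (u : Site d → (Matrix n n ℂ)ˣ) : Site d → Fin d → Matrix n n ℂ :=
  fun y κ => mlog ((((W y κ)⁻¹ : (Matrix n n ℂ)ˣ) : Matrix n n ℂ) * ((gaugeAct u U' y κ : (Matrix n n ℂ)ˣ) : Matrix n n ℂ))

/-- **`h(u)`**: the corner logs `h(u)(z) := mlog(u(M•z))`, `M = L^{k+1}`. [folklore] -/
def cornerLog (L k : ℕ) (u : Site d → (Matrix n n ℂ)ˣ) : Site d → Matrix n n ℂ :=
  fun z => mlog ((u (((L : ℤ) ^ (k + 1)) • z) : (Matrix n n ℂ)ˣ) : Matrix n n ℂ)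

/-- **`φ(u)`**: the coarse datum `φ(u) := dirIter X(u) − gaugeDir_V h(u)`, `V = cavgIter L (k+1) W`. [folklore] -/
def coarseDatum [Nonempty n] (L k : ℕ) (W U' : Site d → Fin d → (Matrix n n ℂ)ˣ) (u : Site d → (Matrix n n ℂ)ˣ) : Site d → Fin d → Matrix n n ℂ :=
  fun z κ => dirIter L (k + 1) W (repLog W U' u) z κ - gaugeDir (cavgIter L (k + 1) W) (cornerLog L k u) z κ

/-- a NORMALISED SLICE SPLIT of a tangent part `T` against the corner data `h`: `T = Y + gaugeDir W ζ`, `Y ∈ 𝒯_E(W)`, `ζ` skew `(tower)`-periodic with nested mean `−(framePotW T − h)`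
(the shape produced by `NE7SliceGaugeFunctionSized.exists_fullGauge_split_sized` and `NE7SliceStepOneStep.one_step_split_sized`). [folklore] -/
def IsNormalisedSplit [Nonempty n] (L k N : ℕ) (W : Site d → Fin d → (Matrix n n ℂ)ˣ) (T : Site d → Fin d → Matrix n n ℂ) (h : Site d → Matrix n n ℂ)
    (ζ : Site d → Matrix n n ℂ) (Y : Site d → Fin d → Matrix n n ℂ) : Prop :=
  (∀ y, ζ y ∈ skewAdjoint (Matrix n n ℂ)) ∧ (∀ (y : Site d) (i : Fin d), ζ (y + ((tower L N (k + 1) : ℕ) : ℤ) • e i) = ζ y) ∧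
    Y ∈ energyBlockLandauW (d := d) (n := n) L N (k + 1) W ∧ (∀ y μ, T y μ = Y y μ + gaugeDir W ζ y μ) ∧
    (∀ z, bmeanIterW L (k + 1) W ζ z = -(framePotW L (k + 1) W T z - h z))

section State

variable [Nonempty n] {L : ℕ} (hL : 2 ≤ L) (k : ℕ) {W : Site d → Fin d → (Matrix n n ℂ)ˣ} {x : ℝ} (hWu : IsUnitaryCfg W) (hx : 0 ≤ x) (hs : LevelSmall d L k x)
  (hWx : SmallField W x) (N : ℕ) [NeZero N] (hθ : cruxC d L * (((L : ℝ) ^ (k + 1)) ^ 2 * x) < 1) (U' : Site d → Fin d → (Matrix n n ℂ)ˣ)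

open Classical in
/-- **`N(u)`**: the normal part `rightInvW φ(u)` (defined when `φ(u)` is skew — true on the working region —, else `0`). [folklore] -/
def normalPart (u : Site d → (Matrix n n ℂ)ˣ) : Site d → Fin d → Matrix n n ℂ :=
  if hφ : IsSkewDir (coarseDatum L k W U' u) then rightInvW hL k hWu hx hs hWx N hθ hφ else fun _ _ => 0

/-- on the working region `N(u) = rightInvW φ(u)` (any skewness witness). [folklore] -/
theorem normalPart_eq {u : Site d → (Matrix n n ℂ)ˣ} (hφ : IsSkewDir (coarseDatum L k W U' u)) :
    normalPart hL k hWu hx hs hWx N hθ U' u = rightInvW hL k hWu hx hs hWx N hθ hφ := by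
  rw [normalPart, dif_pos hφ]

/-- **`T(u)`**: the tangent part `X(u) − N(u)` (so `dirIter T(u) = gaugeDir_V h(u)` on the working region, `rightInvW_exact`). [folklore] -/
def tangentPart (u : Site d → (Matrix n n ℂ)ˣ) : Site d → Fin d → Matrix n n ℂ :=
  fun y κ => repLog W U' u y κ - normalPart hL k hWu hx hs hWx N hθ U' u y κ

open Classical in
/-- **`ζ(u)`**: the gauge function of a CHOSEN normalised split of `(T(u), h(u))` (`0` if none exists; its `gaugeDir W ζ(u)` is canonical, `slice_split_unique`). [folklore] -/
def gaugeFun (u : Site d → (Matrix n n ℂ)ˣ) : Site d → Matrix n n ℂ :=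
  if h : ∃ p : (Site d → Matrix n n ℂ) × (Site d → Fin d → Matrix n n ℂ),
      IsNormalisedSplit L k N W (tangentPart hL k hWu hx hs hWx N hθ U' u) (cornerLog L k u) p.1 p.2 then (Classical.choose h).1
  else fun _ => 0

open Classical in
/-- **`Ỹ(u)`**: the slice part of the chosen normalised split (`T(u)` itself if none exists). [folklore] -/
def slicePart (u : Site d → (Matrix n n ℂ)ˣ) : Site d → Fin d → Matrix n n ℂ :=
  if h : ∃ p : (Site d → Matrix n n ℂ) × (Site d → Fin d → Matrix n n ℂ),
      IsNormalisedSplit L k N W (tangentPart hL k hWu hx hs hWx N hθ U' u) (cornerLog L k u) p.1 p.2 then (Classical.choose h).2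
  else tangentPart hL k hWu hx hs hWx N hθ U' u

/-- the chosen pair IS a normalised split whenever one exists. [folklore] -/
theorem split_spec {u : Site d → (Matrix n n ℂ)ˣ}
    (h : ∃ p : (Site d → Matrix n n ℂ) × (Site d → Fin d → Matrix n n ℂ),
      IsNormalisedSplit L k N W (tangentPart hL k hWu hx hs hWx N hθ U' u) (cornerLog L k u) p.1 p.2) :
    IsNormalisedSplit L k N W (tangentPart hL k hWu hx hs hWx N hθ U' u) (cornerLog L k u)
      (gaugeFun hL k hWu hx hs hWx N hθ U' u) (slicePart hL k hWu hx hs hWx N hθ U' u) := by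
  rw [gaugeFun, slicePart, dif_pos h, dif_pos h]
  exact Classical.choose_spec h

/-- **`m(u)`**: the frame mismatch `sup_z ‖framePotW T(u) z − h(u) z‖` (box sup over the coarse period `N`). [folklore] -/
def frameMismatch (u : Site d → (Matrix n n ℂ)ˣ) : ℝ :=
  siteSup N fun z => ‖framePotW L (k + 1) W (tangentPart hL k hWu hx hs hWx N hθ U' u) z - cornerLog L k u z‖

/-- **`Df(u)`**: THE DEFECT `δ(u) + m(u)∕M`, `δ(u) := sup‖gaugeDir W ζ(u)‖` (box sup over the fine period `tower L N (k+1)`), `M = L^{k+1}`. [folklore] -/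
def sliceDefect (u : Site d → (Matrix n n ℂ)ˣ) : ℝ :=
  bondSup (tower L N (k + 1)) (fun y μ => ‖gaugeDir W (gaugeFun hL k hWu hx hs hWx N hθ U' u) y μ‖)
    + frameMismatch hL k hWu hx hs hWx N hθ U' u / (L : ℝ) ^ (k + 1)

/-- **THE STEP** `u ↦ e^{−ζ(u)}·u`. [folklore] -/
def sliceStep (u : Site d → (Matrix n n ℂ)ˣ) : Site d → (Matrix n n ℂ)ˣ :=
  (fun y => expUnit (-gaugeFun hL k hWu hx hs hWx N hθ U' u y)) * u

/-- **THE SIZE PAIR** `(s(u), η_h(u)) := (sup‖X(u)‖, sup‖h(u)‖)` (box sups over the fine and the coarse period). [folklore] -/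
def sizePair (u : Site d → (Matrix n n ℂ)ˣ) : ℝ × ℝ :=
  (bondSup (tower L N (k + 1)) (fun y μ => ‖repLog W U' u y μ‖), siteSup N fun z => ‖cornerLog L k u z‖)

/-- the defect is nonnegative (`L ≥ 2`). [folklore] -/
theorem sliceDefect_nonneg (u : Site d → (Matrix n n ℂ)ˣ) : 0 ≤ sliceDefect hL k hWu hx hs hWx N hθ U' u := by
  have hM : 0 < (L : ℝ) ^ (k + 1) := pow_pos (by exact_mod_cast (by omega : 0 < L)) _
  exact add_nonneg (bondSup_nonneg fun y μ => norm_nonneg _) (div_nonneg (siteSup_nonneg fun z => norm_nonneg _) hM.le)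

end State

end

end Summit.QuantumFields.BalabanUV.T4Continuum.NE7SliceIterationState
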